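import Literature.Probability.LatticeModels.LupuCouplingTwoPoint
import HarnessLib

/-!
# Lupu's coupling: the two-point bound in infinite volume and its decay

Topic `Literature/Probability/LatticeModels`. Brick 7b of the proof of
`Literature.Probability.LatticeModels.Lupu2016_cableSignClustersBounded` (Lupu 2016, Prop. 5.5);
continuation of `LupuCouplingTwoPoint.lean` (the bound in boxes). Contents (all proved):

* `prodBernoulli_symWeight_openConn_eq_iSup` — `P_φ(x ↔ y) = sup_m P_φ(x ↔ y in Λ_m)` (an open
  path is finite; non-lattice bonds are a.s. closed), and measurability of `φ ↦ P_φ(x ↔ y)`;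
* `lintegral_abs_mul_mul_prodBernoulli_openConn_le` — **`E[|φ_x φ_y| · P_φ(x ↔ y)] ≤ G(x - y)`**
  by monotone convergence;
* `lintegral_prodBernoulli_openConn_le` — the **decay bound**
  `∫ P_φ(x ↔ y) dν ≤ ν{|φ_x| < δ} + ν{|φ_y| < δ} + δ⁻² G(x - y)` for every `δ > 0`, our
  substitute for Lupu's exact two-point formula (Prop. 5.2): as `|x - y| → ∞` and then `δ → 0`
  the right-hand side vanishes (`tendsto_latticeGreen_cofinite`), which is all Prop. 5.5 needs.

References: T. Lupu, Ann. Probab. 44 (2016), Prop. 5.2 and Prop. 5.5 [`Lupu2016`].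
-/

noncomputable section

namespace Literature.Probability.LatticeModels

open _root_.MeasureTheory _root_.ProbabilityTheory Finset Filter _root_.Topology
  Literature.Probability.Percolation
open scoped ENNReal NNReal

variable {d : ℕ}

/-! ### From boxes to the infinite-volume connection event -/

/-- Under the conditional bond law only lattice bonds are open: the configurations not contained
in the edge set of `ℤ^d` form a null set (the weights vanish off edges). [folklore] -/
theorem prodBernoulli_symWeight_not_subset_edgeSet (φ : Site d → ℝ) :
    (prodBernoulli (symWeight φ)) {ω | ¬ ω ⊆ (zdGraph d).edgeSet} = 0 := by
  have hsub : {ω : Set (Sym2 (Site d)) | ¬ ω ⊆ (zdGraph d).edgeSet} ⊆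
      ⋃ e : {e : Sym2 (Site d) // e ∉ (zdGraph d).edgeSet}, {ω | e.1 ∈ ω} := by
    intro ω hω
    simp only [Set.mem_setOf_eq, Set.not_subset] at hω
    obtain ⟨e, heω, he⟩ := hω
    exact Set.mem_iUnion.2 ⟨⟨e, he⟩, heω⟩
  refine measure_mono_null hsub (measure_iUnion_null fun e => ?_)
  rw [← ofReal_measureReal (measure_ne_top _ _), prodBernoulli_real_setOf_mem,
    symWeight_of_not_mem φ e.2]
  simp

/-- `{x ↔ y}` is, up to the null set of non-lattice configurations, the increasing union of the
events `{x ↔ y in Λ_m}` (an open path is finite). [folklore] -/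
theorem openConn_subset_iUnion_connWithin (x y : Site d) :
    openConn x y ∩ {ω | ω ⊆ (zdGraph d).edgeSet} ⊆ ⋃ m : ℕ, connWithin (box d m) x y := by
  classical
  rintro ω ⟨hω, hωE⟩
  obtain ⟨p⟩ := (show (openGraph ω).Reachable x y from hω)
  -- a box containing the support of the path
  obtain ⟨m, hm⟩ : ∃ m : ℕ, ∀ v ∈ p.support.toFinset, v ∈ box d m :=
    ((p.support.toFinset.eventually_all).2 fun v _ => eventually_mem_box v).exists
  refine Set.mem_iUnion.2 ⟨m, ?_⟩
  have hedges : ∀ e ∈ p.edges, e ∈ (openGraph (ω ∩ ↑(edgesIn (zdGraph d) (box d m)))).edgeSet := by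
    intro e he
    induction e using Sym2.ind with
    | _ a b =>
      have hadj := p.adj_of_mem_edges he
      rw [openGraph_adj] at hadj
      rw [SimpleGraph.mem_edgeSet, openGraph_adj]
      refine ⟨⟨hadj.1, ?_⟩, hadj.2⟩
      rw [Finset.mem_coe, mem_edgesIn_iff]
      refine ⟨hωE hadj.1, fun z hz => ?_⟩
      rcases Sym2.mem_iff.1 hz with rfl | rfl
      · exact hm _ (List.mem_toFinset.2 (p.fst_mem_support_of_mem_edges he))
      · exact hm _ (List.mem_toFinset.2 (p.snd_mem_support_of_mem_edges he))
  exact ⟨p.transfer _ hedges⟩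

/-- **`P_φ(x ↔ y) = sup_m P_φ(x ↔ y in Λ_m)`** for every field `φ`. [folklore] -/
theorem prodBernoulli_symWeight_openConn_eq_iSup (φ : Site d → ℝ) (x y : Site d) :
    (prodBernoulli (symWeight φ)) (openConn x y) =
      ⨆ m : ℕ, (prodBernoulli (symWeight φ)) (connWithin (box d m) x y) := by
  have hmono : Monotone fun m : ℕ => connWithin (box d m) x y := fun m m' h ω hω =>
    clusterWithin_mono (box_mono d h) ω x hω
  rw [← hmono.measure_iUnion]
  apply le_antisymm
  · calc (prodBernoulli (symWeight φ)) (openConn x y)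
        ≤ (prodBernoulli (symWeight φ)) ((openConn x y ∩ {ω | ω ⊆ (zdGraph d).edgeSet}) ∪
            {ω | ¬ ω ⊆ (zdGraph d).edgeSet}) := measure_mono fun ω hω => by
          by_cases h : ω ⊆ (zdGraph d).edgeSet
          · exact Or.inl ⟨hω, h⟩
          · exact Or.inr h
      _ ≤ (prodBernoulli (symWeight φ)) (openConn x y ∩ {ω | ω ⊆ (zdGraph d).edgeSet}) +
            (prodBernoulli (symWeight φ)) {ω | ¬ ω ⊆ (zdGraph d).edgeSet} := measure_union_le _ _
      _ ≤ (prodBernoulli (symWeight φ)) (⋃ m : ℕ, connWithin (box d m) x y) := by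
          rw [prodBernoulli_symWeight_not_subset_edgeSet, add_zero]
          exact measure_mono (openConn_subset_iUnion_connWithin x y)
  · refine measure_mono (Set.iUnion_subset fun m ω hω => ?_)
    exact openCluster_mono Set.inter_subset_left x hω

/-- `φ ↦ P_φ(x ↔ y)` is measurable (a supremum of continuous functions). [folklore] -/
theorem measurable_prodBernoulli_symWeight_openConn (x y : Site d) :
    Measurable fun φ : Site d → ℝ => (prodBernoulli (symWeight φ)) (openConn x y) := by
  simp_rw [prodBernoulli_symWeight_openConn_eq_iSup]
  refine Measurable.iSup fun m => ?_
  have : (fun φ : Site d → ℝ => (prodBernoulli (symWeight φ)) (connWithin (box d m) x y)) =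
      fun φ => ENNReal.ofReal ((prodBernoulli (symWeight φ)).real (connWithin (box d m) x y)) := by
    funext φ; rw [ofReal_measureReal (measure_ne_top _ _)]
  rw [this]
  exact ENNReal.measurable_ofReal.comp
    (continuous_prodBernoulli_symWeight_real (determinedBy_connWithin (box d m) x y)).measurable

namespace IsDiscreteGFF

variable {ν : Measure (Site d → ℝ)}

/-- **The two-point bound** (`d ≥ 3`): `E[|φ_x φ_y| · P_φ(x ↔ y)] ≤ G(x - y)`, `G = latticeGreen/2`,
by monotone convergence from the boxes. [cite: Lupu2016, Prop. 5.2] -/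
theorem lintegral_abs_mul_mul_prodBernoulli_openConn_le (hν : IsDiscreteGFF ν (coordProc d))
    (hd : 3 ≤ d) (x y : Site d) :
    ∫⁻ φ, ENNReal.ofReal |φ x * φ y| * (prodBernoulli (symWeight φ)) (openConn x y) ∂ν ≤
      ENNReal.ofReal (latticeGreen (x - y) / 2) := by
  have hprob : IsProbabilityMeasure ν := hν.1.isProbabilityMeasure
  set f : ℕ → (Site d → ℝ) → ℝ≥0∞ := fun m φ =>
    ENNReal.ofReal |φ x * φ y| * (prodBernoulli (symWeight φ)) (connWithin (box d m) x y) with hf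
  have hfm : ∀ m, Measurable (f m) := fun m =>
    (ENNReal.measurable_ofReal.comp ((measurable_pi_apply x).mul (measurable_pi_apply y)).abs).mul
      (by
        have : (fun φ : Site d → ℝ => (prodBernoulli (symWeight φ)) (connWithin (box d m) x y)) =
            fun φ => ENNReal.ofReal ((prodBernoulli (symWeight φ)).real (connWithin (box d m) x y)) := by
          funext φ; rw [ofReal_measureReal (measure_ne_top _ _)]
        rw [this]
        exact ENNReal.measurable_ofReal.comp (continuous_prodBernoulli_symWeight_real
          (determinedBy_connWithin (box d m) x y)).measurable)
  have hfmono : Monotone f := fun m m' h φ =>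
    mul_le_mul' le_rfl (measure_mono fun ω hω => clusterWithin_mono (box_mono d h) ω x hω)
  calc ∫⁻ φ, ENNReal.ofReal |φ x * φ y| * (prodBernoulli (symWeight φ)) (openConn x y) ∂ν
      = ∫⁻ φ, ⨆ m, f m φ ∂ν := by
        refine lintegral_congr fun φ => ?_
        rw [prodBernoulli_symWeight_openConn_eq_iSup, ENNReal.mul_iSup]
    _ = ⨆ m, ∫⁻ φ, f m φ ∂ν := lintegral_iSup hfm hfmono
    _ ≤ ENNReal.ofReal (latticeGreen (x - y) / 2) := iSup_le fun m => by
        have hint : Integrable (fun φ : Site d → ℝ =>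
            |φ x * φ y| * (prodBernoulli (symWeight φ)).real (connWithin (box d m) x y)) ν := by
          simp_rw [mul_comm _ ((prodBernoulli _).real _)]
          refine (hν.integrable_coord_mul x y).abs.bdd_mul (c := 1) ?_
            (Eventually.of_forall fun φ => ?_)
          · exact (continuous_prodBernoulli_symWeight_real
              (determinedBy_connWithin (box d m) x y)).measurable.aestronglyMeasurable
          · rw [Real.norm_eq_abs, abs_of_nonneg measureReal_nonneg]; exact measureReal_le_one
        have heq : ∫⁻ φ, f m φ ∂ν = ENNReal.ofReal (∫ φ, |φ x * φ y| *
            (prodBernoulli (symWeight φ)).real (connWithin (box d m) x y) ∂ν) := by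
          rw [ofReal_integral_eq_lintegral_ofReal hint
            (ae_of_all _ fun φ => mul_nonneg (abs_nonneg _) measureReal_nonneg)]
          refine lintegral_congr fun φ => ?_
          rw [hf, ENNReal.ofReal_mul (abs_nonneg _), ofReal_measureReal (measure_ne_top _ _)]
        rw [heq]
        exact ENNReal.ofReal_le_ofReal (hν.integral_abs_mul_mul_prodBernoulli_connWithin_box_le hd m x y)

/-- **Two-point decay bound** (`d ≥ 3`): for every `δ > 0`,
`∫ P_φ(x ↔ y) dν ≤ ν{|φ_x| < δ} + ν{|φ_y| < δ} + δ⁻² G(x - y)`: on `{|φ_x| ≥ δ, |φ_y| ≥ δ}` one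
has `P_φ(x ↔ y) ≤ δ⁻² |φ_x φ_y| P_φ(x ↔ y)`. This replaces Lupu's exact two-point formula
`P(x ↔ y) = (2/π) arcsin(G(x,y)/G(0,0))` (Prop. 5.2): both tend to `0` as `|x - y| → ∞`, which is
all the proof of Prop. 5.5 uses. [cite: Lupu2016, Prop. 5.2] -/
theorem lintegral_prodBernoulli_openConn_le (hν : IsDiscreteGFF ν (coordProc d)) (hd : 3 ≤ d)
    (x y : Site d) {δ : ℝ} (hδ : 0 < δ) :
    ∫⁻ φ, (prodBernoulli (symWeight φ)) (openConn x y) ∂ν ≤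
      ν {φ | |φ x| < δ} + ν {φ | |φ y| < δ} +
        ENNReal.ofReal (δ ^ 2)⁻¹ * ENNReal.ofReal (latticeGreen (x - y) / 2) := by
  have hprob : IsProbabilityMeasure ν := hν.1.isProbabilityMeasure
  have hpt : ∀ φ : Site d → ℝ, (prodBernoulli (symWeight φ)) (openConn x y) ≤
      {φ | |φ x| < δ}.indicator 1 φ + {φ | |φ y| < δ}.indicator 1 φ +
        ENNReal.ofReal (δ ^ 2)⁻¹ *
          (ENNReal.ofReal |φ x * φ y| * (prodBernoulli (symWeight φ)) (openConn x y)) := by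
    intro φ
    by_cases hx : |φ x| < δ
    · have : {φ : Site d → ℝ | |φ x| < δ}.indicator (1 : (Site d → ℝ) → ℝ≥0∞) φ = 1 := by
        simp [Set.indicator_of_mem (show φ ∈ {φ : Site d → ℝ | |φ x| < δ} from hx)]
      rw [this]
      calc (prodBernoulli (symWeight φ)) (openConn x y) ≤ 1 := prob_le_one
        _ ≤ 1 + {φ | |φ y| < δ}.indicator 1 φ + _ := by
            rw [add_assoc]; exact le_self_add
    · by_cases hy : |φ y| < δ
      · have : {φ : Site d → ℝ | |φ y| < δ}.indicator (1 : (Site d → ℝ) → ℝ≥0∞) φ = 1 := by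
          simp [Set.indicator_of_mem (show φ ∈ {φ : Site d → ℝ | |φ y| < δ} from hy)]
        rw [this]
        calc (prodBernoulli (symWeight φ)) (openConn x y) ≤ 1 := prob_le_one
          _ ≤ {φ | |φ x| < δ}.indicator 1 φ + 1 + _ := by
              rw [add_comm ({φ : Site d → ℝ | |φ x| < δ}.indicator 1 φ), add_assoc]
              exact le_self_add
      · -- `|φ_x φ_y| ≥ δ²`
        push Not at hx hy
        have hprod : δ ^ 2 ≤ |φ x * φ y| := by
          rw [abs_mul, sq]; exact mul_le_mul hx hy hδ.le (abs_nonneg _)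
        have hone : (1 : ℝ≥0∞) ≤ ENNReal.ofReal (δ ^ 2)⁻¹ * ENNReal.ofReal |φ x * φ y| := by
          rw [← ENNReal.ofReal_mul (inv_nonneg.2 (sq_nonneg δ)), ← ENNReal.ofReal_one]
          refine ENNReal.ofReal_le_ofReal ?_
          rw [inv_mul_eq_div, le_div_iff₀ (by positivity)]
          linarith
        calc (prodBernoulli (symWeight φ)) (openConn x y)
            = 1 * (prodBernoulli (symWeight φ)) (openConn x y) := (one_mul _).symm
          _ ≤ (ENNReal.ofReal (δ ^ 2)⁻¹ * ENNReal.ofReal |φ x * φ y|) *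
                (prodBernoulli (symWeight φ)) (openConn x y) := mul_le_mul' hone le_rfl
          _ = ENNReal.ofReal (δ ^ 2)⁻¹ *
                (ENNReal.ofReal |φ x * φ y| * (prodBernoulli (symWeight φ)) (openConn x y)) := by
              rw [mul_assoc]
          _ ≤ _ := le_add_self
  have hmx : MeasurableSet {φ : Site d → ℝ | |φ x| < δ} :=
    measurableSet_lt (measurable_pi_apply x).abs measurable_const
  have hmy : MeasurableSet {φ : Site d → ℝ | |φ y| < δ} :=
    measurableSet_lt (measurable_pi_apply y).abs measurable_const
  calc ∫⁻ φ, (prodBernoulli (symWeight φ)) (openConn x y) ∂ν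
      ≤ ∫⁻ φ, ({φ | |φ x| < δ}.indicator 1 φ + {φ | |φ y| < δ}.indicator 1 φ +
          ENNReal.ofReal (δ ^ 2)⁻¹ *
            (ENNReal.ofReal |φ x * φ y| * (prodBernoulli (symWeight φ)) (openConn x y))) ∂ν :=
        lintegral_mono hpt
    _ = ν {φ | |φ x| < δ} + ν {φ | |φ y| < δ} + ENNReal.ofReal (δ ^ 2)⁻¹ *
          ∫⁻ φ, ENNReal.ofReal |φ x * φ y| * (prodBernoulli (symWeight φ)) (openConn x y) ∂ν := by
        have hmC : Measurable fun φ : Site d → ℝ =>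
            ENNReal.ofReal |φ x * φ y| * (prodBernoulli (symWeight φ)) (openConn x y) :=
          (ENNReal.measurable_ofReal.comp ((measurable_pi_apply x).mul
            (measurable_pi_apply y)).abs).mul (measurable_prodBernoulli_symWeight_openConn x y)
        have hmAB : Measurable fun φ : Site d → ℝ =>
            {φ : Site d → ℝ | |φ x| < δ}.indicator (1 : (Site d → ℝ) → ℝ≥0∞) φ +
              {φ : Site d → ℝ | |φ y| < δ}.indicator 1 φ :=
          (measurable_one.indicator hmx).add (measurable_one.indicator hmy)
        have h1 : ∫⁻ φ, ({φ | |φ x| < δ}.indicator 1 φ + {φ | |φ y| < δ}.indicator 1 φ +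
            ENNReal.ofReal (δ ^ 2)⁻¹ *
              (ENNReal.ofReal |φ x * φ y| * (prodBernoulli (symWeight φ)) (openConn x y))) ∂ν =
            ∫⁻ φ, ({φ | |φ x| < δ}.indicator 1 φ + {φ | |φ y| < δ}.indicator 1 φ) ∂ν +
              ∫⁻ φ, ENNReal.ofReal (δ ^ 2)⁻¹ *
                (ENNReal.ofReal |φ x * φ y| * (prodBernoulli (symWeight φ)) (openConn x y)) ∂ν :=
          lintegral_add_left hmAB _
        have h2 : ∫⁻ φ, ({φ | |φ x| < δ}.indicator 1 φ + {φ | |φ y| < δ}.indicator 1 φ) ∂ν =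
            ∫⁻ φ, {φ | |φ x| < δ}.indicator 1 φ ∂ν + ∫⁻ φ, {φ | |φ y| < δ}.indicator 1 φ ∂ν :=
          lintegral_add_left (measurable_one.indicator hmx) _
        rw [h1, h2, lintegral_indicator_one hmx, lintegral_indicator_one hmy,
          lintegral_const_mul _ hmC]
    _ ≤ _ := by
        gcongr
        exact hν.lintegral_abs_mul_mul_prodBernoulli_openConn_le hd x y

end IsDiscreteGFF

end Literature.Probability.LatticeModels
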